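import Mathlib.Analysis.Analytic.Constructions
import Mathlib.Analysis.Analytic.Linear
import Literature.NumberTheory.Transcendental.KZCubicalCalculus
import Literature.NumberTheory.Transcendental.KZLogCalculusProofs
import Literature.NumberTheory.Transcendental.SemialgebraicMapsProofs
import Literature.ModelTheory.ExponentialFields.SemialgebraicInterior

/-!
# `SectorToKernel`, line `effective-cube-surjection`: dyadic subdivision, one coordinate (stub S2)

Helper file for the stub `stub_admissibleOfTame` of the crux `FurushoPentagon.SectorToKernel`
(stmt-KontsevichZagierPeriods-10813). Inside the Kontsevich–Zagier calculus of moves, a tame cube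
class `[[0,1]ⁿ, f]` (`f` analytic near the closed cube and `ℚ`-semialgebraic on it) is equivalent to the
tame cube class of its `N`-fold AVERAGE of rescalings, `N = 2ʲ`,

  `[[0,1]ⁿ, f] ∼ [[0,1]ⁿ, x ↦ ∑_{k ∈ {0,…,N-1}ⁿ} N⁻ⁿ f ((k + x)/N)]`,

by `j` rounds of the dyadic subdivision move along each coordinate
(`KZ.cubicalSubdivGens_subset_relations`: `[f] − [½ f(x with xᵢ ↦ xᵢ/2)] − [½ f(x with xᵢ ↦ (1+xᵢ)/2)]`)
re-summed by integrand additivity (`KZ.cubicalLinGens_subset_relations`). All intermediate integrands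
are global functions (finite sums of `f` composed with polynomial self-maps of the cube over `ℚ`), so
that tameness is preserved mechanically. THIS FILE: the tameness toolkit and the one-coordinate averages
`A_{i,N} f (x) = ∑_{k<N} N⁻¹ f (x with xᵢ ↦ (k + xᵢ)/N)` (`A_{i,N} ∘ A_{i,2} = A_{i,2N}`, induction on
`j`); the several-coordinate bookkeeping is in the sequel file `…AdmissibleOfTameSubdiv.lean`.

References: M. Kontsevich, D. Zagier, *Periods* (2001), §1.2 rules (1)–(2); J. Ayoub, *Periods and
the conjectures of Grothendieck and Kontsevich–Zagier* (2014), Def. 9 and Rem. 12.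
-/

noncomputable section

namespace Summit.KontsevichZagierPeriods.FurushoPentagon.SectorToKernel

open Set MeasureTheory
open Literature.NumberTheory.Transcendental
open Literature.NumberTheory.Transcendental.KZ hiding cubicalSpan

/-! ## Tameness toolkit: polynomial self-maps of the cube, constants, sums -/

/-- Composition of a function analytic near the cube and `ℚ`-semialgebraic on it with a polynomial map
over `ℚ` sending the cube into itself is again analytic near the cube and `ℚ`-semialgebraic on it
(`IsSemialgebraicFunOn.comp_isSemialgebraicMapOn_holds`). [Bochnak–Coste–Roy 1998, Prop. 2.2.6; folklore] -/
theorem admOfTame_tame_comp_polynomialMap {n : ℕ} {f : (Fin n → ℝ) → ℝ}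
    (hf : AnalyticOnNhd ℝ f (KZ.cube n) ∧ IsSemialgebraicFunOn ℚ (KZ.cube n) f)
    {Φ : (Fin n → ℝ) → (Fin n → ℝ)} (P : Fin n → MvPolynomial (Fin n) ℚ)
    (hΦ : ∀ x j, Φ x j = MvPolynomial.aeval x (P j)) (hmaps : MapsTo Φ (KZ.cube n) (KZ.cube n)) :
    AnalyticOnNhd ℝ (fun x => f (Φ x)) (KZ.cube n) ∧
      IsSemialgebraicFunOn ℚ (KZ.cube n) (fun x => f (Φ x)) := by
  have hΦeq : Φ = fun x j => MvPolynomial.aeval x (P j) := funext fun x => funext fun j => hΦ x j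
  constructor
  · have hΦa : AnalyticOnNhd ℝ Φ (KZ.cube n) := by
      rw [hΦeq]
      exact (analyticOnNhd_pi_iff.2 fun j =>
        Literature.ModelTheory.ExponentialFields.analyticOnNhd_aeval (P j)).mono (subset_univ _)
    exact hf.1.comp hΦa hmaps
  · have hΦs : IsSemialgebraicMapOn ℚ (KZ.cube n) Φ := by
      rw [hΦeq]
      exact isSemialgebraicMapOn_aeval (R := ℝ) KZ.isSemialgebraic_cube P
    exact IsSemialgebraicFunOn.comp_isSemialgebraicMapOn_holds hf.2 hΦs hmaps

/-- A rational constant multiple of a tame function is tame. [Bochnak–Coste–Roy 1998, Prop. 2.2.6; folklore] -/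
theorem admOfTame_tame_const_mul {n : ℕ} {f : (Fin n → ℝ) → ℝ}
    (hf : AnalyticOnNhd ℝ f (KZ.cube n) ∧ IsSemialgebraicFunOn ℚ (KZ.cube n) f) (c : ℝ) (q : ℚ)
    (hc : algebraMap ℚ ℝ q = c) :
    AnalyticOnNhd ℝ (fun x => c * f x) (KZ.cube n) ∧
      IsSemialgebraicFunOn ℚ (KZ.cube n) (fun x => c * f x) := by
  refine ⟨analyticOnNhd_const.mul hf.1, ?_⟩
  have hcs : IsSemialgebraicFunOn ℚ (KZ.cube n) (fun _ : Fin n → ℝ => c) :=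
    (isSemialgebraicFunOn_aeval (R := ℝ) KZ.isSemialgebraic_cube
      (MvPolynomial.C q : MvPolynomial (Fin n) ℚ)).congr fun x _ => by
        show MvPolynomial.aeval x (MvPolynomial.C q) = c
        rw [MvPolynomial.aeval_C, hc]
  exact IsSemialgebraicFunOn.mul_holds hcs hf.2

/-- Finite sums of tame functions are tame. [Bochnak–Coste–Roy 1998, Prop. 2.2.6; folklore] -/
theorem admOfTame_tame_sum {n : ℕ} {ι : Type*} (s : Finset ι) {f : ι → (Fin n → ℝ) → ℝ}
    (hf : ∀ i ∈ s, AnalyticOnNhd ℝ (f i) (KZ.cube n) ∧ IsSemialgebraicFunOn ℚ (KZ.cube n) (f i)) :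
    AnalyticOnNhd ℝ (fun x => ∑ i ∈ s, f i x) (KZ.cube n) ∧
      IsSemialgebraicFunOn ℚ (KZ.cube n) (fun x => ∑ i ∈ s, f i x) := by
  classical
  induction s using Finset.induction_on with
  | empty =>
    simp only [Finset.sum_empty]
    refine ⟨analyticOnNhd_const, ?_⟩
    simpa using isSemialgebraicFunOn_aeval (R := ℝ) KZ.isSemialgebraic_cube
      (0 : MvPolynomial (Fin n) ℚ)
  | insert a s ha ih =>
    simp only [Finset.sum_insert ha]
    have h1 := hf a (Finset.mem_insert_self a s)
    have h2 := ih fun i hi => hf i (Finset.mem_insert_of_mem hi)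
    exact ⟨h1.1.add h2.1, IsSemialgebraicFunOn.add_holds h1.2 h2.2⟩

/-- The rescaling `x ↦ (x with xᵢ ↦ (k + xᵢ)/N)`, `k < N`, maps the cube into itself. [folklore] -/
theorem admOfTame_update_mem_cube {n : ℕ} (i : Fin n) {N : ℕ} (k : Fin N) {x : Fin n → ℝ}
    (hx : x ∈ KZ.cube n) :
    Function.update x i ((((k : ℕ) : ℝ) + x i) / N) ∈ KZ.cube n := by
  have hN : (0 : ℝ) < N := by exact_mod_cast k.pos
  have hk : ((k : ℕ) : ℝ) + 1 ≤ N := by exact_mod_cast k.2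
  have hxi := KZ.mem_cube.1 hx i
  have hk0 : (0 : ℝ) ≤ ((k : ℕ) : ℝ) := Nat.cast_nonneg _
  refine KZ.update_mem_cube hx i (div_nonneg (by linarith [hxi.1]) hN.le) ?_
  rw [div_le_one hN]
  linarith [hxi.2]

/-- **Tameness of the one-coordinate average** `x ↦ ∑_{k<N} N⁻¹ f (x with xᵢ ↦ (k + xᵢ)/N)`.
[Bochnak–Coste–Roy 1998, Prop. 2.2.6; folklore] -/
theorem admOfTame_tame_avg1 {n : ℕ} (i : Fin n) (N : ℕ) {f : (Fin n → ℝ) → ℝ}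
    (hf : AnalyticOnNhd ℝ f (KZ.cube n) ∧ IsSemialgebraicFunOn ℚ (KZ.cube n) f) :
    AnalyticOnNhd ℝ (fun x => ∑ k : Fin N, (N : ℝ)⁻¹ *
        f (Function.update x i ((((k : ℕ) : ℝ) + x i) / N))) (KZ.cube n) ∧
      IsSemialgebraicFunOn ℚ (KZ.cube n) (fun x => ∑ k : Fin N, (N : ℝ)⁻¹ *
        f (Function.update x i ((((k : ℕ) : ℝ) + x i) / N))) := by
  classical
  refine admOfTame_tame_sum Finset.univ fun k _ => ?_
  refine admOfTame_tame_const_mul ?_ _ ((N : ℚ)⁻¹) (by simp)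
  refine admOfTame_tame_comp_polynomialMap hf
    (fun j => if j = i then MvPolynomial.C (((k : ℕ) : ℚ) / N) + MvPolynomial.C ((N : ℚ)⁻¹) *
      MvPolynomial.X i else MvPolynomial.X j) (fun x j => ?_) fun x hx => admOfTame_update_mem_cube i k hx
  by_cases hj : j = i
  · subst hj
    simp [Function.update_self]
    ring
  · simp [hj]

/-! ## Relations toolkit -/

/-- Chaining two relations. [Kontsevich–Zagier 2001, §1.2] -/
theorem admOfTame_rel_trans {a b c : FormalRep} (h₁ : a - b ∈ relations) (h₂ : b - c ∈ relations) :
    a - c ∈ relations := by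
  have : a - c = (a - b) + (b - c) := by abel
  rw [this]
  exact relations.add_mem h₁ h₂

/-- Tame cube classes of functions agreeing on the cube are equivalent (integrand additivity with a
zero representation, `KZ.of_sub_of_mem_relations_of_eqOn`). [Kontsevich–Zagier 2001, §1.2 rule (1)] -/
theorem admOfTame_rel_congr {n : ℕ} {f g : (Fin n → ℝ) → ℝ}
    (hf : AnalyticOnNhd ℝ f (KZ.cube n) ∧ IsSemialgebraicFunOn ℚ (KZ.cube n) f)
    (hg : AnalyticOnNhd ℝ g (KZ.cube n) ∧ IsSemialgebraicFunOn ℚ (KZ.cube n) g)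
    (h : EqOn f g (KZ.cube n)) :
    of (IntegralRep.tameCube f hf.1 hf.2) - of (IntegralRep.tameCube g hg.1 hg.2) ∈ relations :=
  of_sub_of_mem_relations_of_eqOn rfl h

/-- **One halving round along the coordinate `i`**: `[f] ∼ [x ↦ ∑_{k<2} ½ f (x with xᵢ ↦ (k + xᵢ)/2)]`,
the dyadic subdivision move (`KZ.cubicalSubdivGens_subset_relations`) followed by re-summing the two
halves (`KZ.cubicalLinGens_subset_relations`). [Kontsevich–Zagier 2001, §1.2 rules (1)–(2)] -/
theorem admOfTame_rel_halve {n : ℕ} (i : Fin n) {f A : (Fin n → ℝ) → ℝ}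
    (hf : AnalyticOnNhd ℝ f (KZ.cube n) ∧ IsSemialgebraicFunOn ℚ (KZ.cube n) f)
    (hA : AnalyticOnNhd ℝ A (KZ.cube n) ∧ IsSemialgebraicFunOn ℚ (KZ.cube n) A)
    (hAeq : ∀ x, A x = ∑ k : Fin 2, ((2 : ℕ) : ℝ)⁻¹ *
      f (Function.update x i ((((k : ℕ) : ℝ) + x i) / (2 : ℕ)))) :
    of (IntegralRep.tameCube f hf.1 hf.2) - of (IntegralRep.tameCube A hA.1 hA.2) ∈ relations := by
  -- the two halves, as global functions
  have h₁ : AnalyticOnNhd ℝ (fun x => (1 / 2 : ℝ) * f (Function.update x i (x i / 2))) (KZ.cube n) ∧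
      IsSemialgebraicFunOn ℚ (KZ.cube n) (fun x => (1 / 2 : ℝ) * f (Function.update x i (x i / 2))) := by
    refine admOfTame_tame_const_mul ?_ _ (1 / 2 : ℚ) (by simp) 
    refine admOfTame_tame_comp_polynomialMap hf
      (fun j => if j = i then MvPolynomial.C (1 / 2 : ℚ) * MvPolynomial.X i else MvPolynomial.X j)
      (fun x j => ?_) fun x hx => ?_
    · by_cases hj : j = i
      · subst hj; simp [Function.update_self]; ring
      · simp [hj]
    · have hxi := KZ.mem_cube.1 hx i
      exact KZ.update_mem_cube hx i (by linarith) (by linarith)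
  have h₂ : AnalyticOnNhd ℝ (fun x => (1 / 2 : ℝ) * f (Function.update x i ((1 + x i) / 2)))
      (KZ.cube n) ∧ IsSemialgebraicFunOn ℚ (KZ.cube n)
      (fun x => (1 / 2 : ℝ) * f (Function.update x i ((1 + x i) / 2))) := by
    refine admOfTame_tame_const_mul ?_ _ (1 / 2 : ℚ) (by simp)
    refine admOfTame_tame_comp_polynomialMap hf
      (fun j => if j = i then MvPolynomial.C (1 / 2 : ℚ) * (1 + MvPolynomial.X i) else MvPolynomial.X j)
      (fun x j => ?_) fun x hx => ?_
    · by_cases hj : j = i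
      · subst hj; simp [Function.update_self]; ring
      · simp [hj]
    · have hxi := KZ.mem_cube.1 hx i
      exact KZ.update_mem_cube hx i (by linarith) (by linarith)
  have hsub : of (IntegralRep.tameCube f hf.1 hf.2) - of (IntegralRep.tameCube _ h₁.1 h₁.2) -
      of (IntegralRep.tameCube _ h₂.1 h₂.2) ∈ relations :=
    KZ.cubicalSubdivGens_subset_relations (KZ.mem_cubicalSubdivGens
      (IntegralRep.isTameCube_tameCube _ _ _) (IntegralRep.isTameCube_tameCube _ _ _)
      (IntegralRep.isTameCube_tameCube _ _ _) i (fun x _ => rfl) (fun x _ => rfl))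
  have hlin : of (IntegralRep.tameCube A hA.1 hA.2) - of (IntegralRep.tameCube _ h₁.1 h₁.2) -
      of (IntegralRep.tameCube _ h₂.1 h₂.2) ∈ relations := by
    refine KZ.cubicalLinGens_subset_relations (KZ.mem_cubicalLinGens
      (IntegralRep.isTameCube_tameCube _ _ _) (IntegralRep.isTameCube_tameCube _ _ _)
      (IntegralRep.isTameCube_tameCube _ _ _) fun x _ => ?_)
    simp only [IntegralRep.tameCube_integrand, Pi.add_apply, hAeq, Fin.sum_univ_two, Fin.val_zero,
      Fin.val_one, Nat.cast_zero, Nat.cast_one, Nat.cast_ofNat, zero_add]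
    ring
  have : of (IntegralRep.tameCube f hf.1 hf.2) - of (IntegralRep.tameCube A hA.1 hA.2) =
      (of (IntegralRep.tameCube f hf.1 hf.2) - of (IntegralRep.tameCube _ h₁.1 h₁.2) -
        of (IntegralRep.tameCube _ h₂.1 h₂.2)) -
      (of (IntegralRep.tameCube A hA.1 hA.2) - of (IntegralRep.tameCube _ h₁.1 h₁.2) -
        of (IntegralRep.tameCube _ h₂.1 h₂.2)) := by abel
  rw [this]
  exact relations.sub_mem hsub hlin

/-! ## One coordinate: `A_{i,N} ∘ A_{i,2} = A_{i,2N}` and `[f] ∼ [A_{i,2ʲ} f]` -/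

/-- **Doubling identity** `A_{i,N} (A_{i,2} f) = A_{i,2N} f` (reindexing `(ε, k) ↦ k + N ε`,
`finProdFinEquiv`). [folklore] -/
theorem admOfTame_avg1_double {n : ℕ} (i : Fin n) (f : (Fin n → ℝ) → ℝ) {N : ℕ} (hN : 0 < N)
    (x : Fin n → ℝ) :
    ∑ k : Fin N, (N : ℝ)⁻¹ * ∑ ε : Fin 2, ((2 : ℕ) : ℝ)⁻¹ *
        f (Function.update (Function.update x i ((((k : ℕ) : ℝ) + x i) / N)) i
          ((((ε : ℕ) : ℝ) + Function.update x i ((((k : ℕ) : ℝ) + x i) / N) i) / (2 : ℕ))) =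
      ∑ l : Fin (2 * N), ((2 * N : ℕ) : ℝ)⁻¹ *
        f (Function.update x i ((((l : ℕ) : ℝ) + x i) / (2 * N : ℕ))) := by
  simp only [Function.update_idem, Function.update_self]
  symm
  rw [← (finProdFinEquiv : Fin 2 × Fin N ≃ Fin (2 * N)).sum_comp, Fintype.sum_prod_type,
    Finset.sum_comm]
  simp only [Finset.mul_sum]
  refine Finset.sum_congr rfl fun k _ => Finset.sum_congr rfl fun ε _ => ?_
  have hN' : (N : ℝ) ≠ 0 := by exact_mod_cast hN.ne'
  have hval : ((finProdFinEquiv (ε, k) : Fin (2 * N)) : ℕ) = (k : ℕ) + N * (ε : ℕ) := by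
    simp [finProdFinEquiv]
  have harg : ((((finProdFinEquiv (ε, k) : Fin (2 * N)) : ℕ) : ℝ) + x i) / ((2 * N : ℕ) : ℝ) =
      (((ε : ℕ) : ℝ) + ((((k : ℕ) : ℝ) + x i) / N)) / ((2 : ℕ) : ℝ) := by
    rw [hval]
    push_cast
    field_simp
    ring
  rw [harg]
  push_cast
  ring

/-- `A_{i,1} f = f`: the trivial average. [folklore] -/
theorem admOfTame_rel_avg1_one {n : ℕ} (i : Fin n) {f A : (Fin n → ℝ) → ℝ}
    (hf : AnalyticOnNhd ℝ f (KZ.cube n) ∧ IsSemialgebraicFunOn ℚ (KZ.cube n) f)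
    (hA : AnalyticOnNhd ℝ A (KZ.cube n) ∧ IsSemialgebraicFunOn ℚ (KZ.cube n) A)
    (hAeq : ∀ x, A x = ∑ k : Fin 1, ((1 : ℕ) : ℝ)⁻¹ *
      f (Function.update x i ((((k : ℕ) : ℝ) + x i) / (1 : ℕ)))) :
    of (IntegralRep.tameCube f hf.1 hf.2) - of (IntegralRep.tameCube A hA.1 hA.2) ∈ relations := by
  refine admOfTame_rel_congr hf hA fun x _ => ?_
  rw [hAeq x, Fin.sum_univ_one]
  simp

/-- **Doubling step**: if `[g] ∼ [A_{i,N} g]` for all tame `g`, then `[f] ∼ [A_{i,2N} f]` for all tame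
`f` (halve once, average the halved function, and use the doubling identity).
[Kontsevich–Zagier 2001, §1.2 rules (1)–(2)] -/
theorem admOfTame_rel_avg1_step {n : ℕ} (i : Fin n) {N : ℕ} (hN : 0 < N)
    (hP : ∀ {g B : (Fin n → ℝ) → ℝ}
      (hg : AnalyticOnNhd ℝ g (KZ.cube n) ∧ IsSemialgebraicFunOn ℚ (KZ.cube n) g)
      (hB : AnalyticOnNhd ℝ B (KZ.cube n) ∧ IsSemialgebraicFunOn ℚ (KZ.cube n) B),
      (∀ x, B x = ∑ k : Fin N, (N : ℝ)⁻¹ * g (Function.update x i ((((k : ℕ) : ℝ) + x i) / N))) →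
      of (IntegralRep.tameCube g hg.1 hg.2) - of (IntegralRep.tameCube B hB.1 hB.2) ∈ relations)
    {f A : (Fin n → ℝ) → ℝ}
    (hf : AnalyticOnNhd ℝ f (KZ.cube n) ∧ IsSemialgebraicFunOn ℚ (KZ.cube n) f)
    (hA : AnalyticOnNhd ℝ A (KZ.cube n) ∧ IsSemialgebraicFunOn ℚ (KZ.cube n) A)
    (hAeq : ∀ x, A x = ∑ l : Fin (2 * N), ((2 * N : ℕ) : ℝ)⁻¹ *
      f (Function.update x i ((((l : ℕ) : ℝ) + x i) / (2 * N : ℕ)))) :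
    of (IntegralRep.tameCube f hf.1 hf.2) - of (IntegralRep.tameCube A hA.1 hA.2) ∈ relations := by
  -- halve once
  have hBt := admOfTame_tame_avg1 i 2 hf
  have h1 := admOfTame_rel_halve i hf hBt (fun x => rfl)
  -- average the halved function
  have hCt := admOfTame_tame_avg1 i N hBt
  have h2 := hP hBt hCt (fun x => rfl)
  -- compare with `A`
  have h3 : of (IntegralRep.tameCube _ hCt.1 hCt.2) - of (IntegralRep.tameCube A hA.1 hA.2) ∈
      relations := by
    refine admOfTame_rel_congr hCt hA fun x _ => ?_
    rw [hAeq x]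
    exact admOfTame_avg1_double i f hN x
  exact admOfTame_rel_trans (admOfTame_rel_trans h1 h2) h3

/-- **`[f] ∼ [A_{i,2ʲ} f]`** for every tame `f`, by induction on the number `j` of halvings along the
coordinate `i`. [Kontsevich–Zagier 2001, §1.2 rules (1)–(2); Ayoub 2014, Rem. 12] -/
theorem admOfTame_rel_avg1_pow {n : ℕ} (i : Fin n) (j : ℕ) :
    ∀ {f A : (Fin n → ℝ) → ℝ}
      (hf : AnalyticOnNhd ℝ f (KZ.cube n) ∧ IsSemialgebraicFunOn ℚ (KZ.cube n) f)
      (hA : AnalyticOnNhd ℝ A (KZ.cube n) ∧ IsSemialgebraicFunOn ℚ (KZ.cube n) A),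
      (∀ x, A x = ∑ k : Fin (2 ^ j), ((2 ^ j : ℕ) : ℝ)⁻¹ *
        f (Function.update x i ((((k : ℕ) : ℝ) + x i) / (2 ^ j : ℕ)))) →
      of (IntegralRep.tameCube f hf.1 hf.2) - of (IntegralRep.tameCube A hA.1 hA.2) ∈ relations := by
  induction j with
  | zero =>
    intro f A hf hA hAeq
    rw [pow_zero] at hAeq
    exact admOfTame_rel_avg1_one i hf hA hAeq
  | succ j ih =>
    intro f A hf hA hAeq
    rw [pow_succ'] at hAeq
    exact admOfTame_rel_avg1_step i (pow_pos two_pos j) ih hf hA hAeq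

/-- **Registered form of `admOfTame_rel_avg1_pow`** (all arguments explicit): `[f] ∼ [A_{i,2ʲ} f]` in
the Kontsevich–Zagier calculus for every tame `f`.
[Kontsevich–Zagier 2001, §1.2 rules (1)–(2); Ayoub 2014, Rem. 12] -/
theorem admOfTame_oneCoordinate :
    ∀ (n : ℕ) (i : Fin n) (j : ℕ) (f A : (Fin n → ℝ) → ℝ) (hf : AnalyticOnNhd ℝ f (Literature.NumberTheory.Transcendental.KZ.cube n) ∧ Literature.NumberTheory.Transcendental.IsSemialgebraicFunOn ℚ (Literature.NumberTheory.Transcendental.KZ.cube n) f) (hA : AnalyticOnNhd ℝ A (Literature.NumberTheory.Transcendental.KZ.cube n) ∧ Literature.NumberTheory.Transcendental.IsSemialgebraicFunOn ℚ (Literature.NumberTheory.Transcendental.KZ.cube n) A), (∀ x, A x = ∑ k : Fin (2 ^ j), ((2 ^ j : ℕ) : ℝ)⁻¹ * f (Function.update x i ((((k : ℕ) : ℝ) + x i) / (2 ^ j : ℕ)))) → Literature.NumberTheory.Transcendental.KZ.of (Literature.NumberTheory.Transcendental.KZ.IntegralRep.tameCube f hf.1 hf.2) - Literature.NumberTheory.Transcendental.KZ.of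 (Literature.NumberTheory.Transcendental.KZ.IntegralRep.tameCube A hA.1 hA.2) ∈ Literature.NumberTheory.Transcendental.KZ.relations :=
  fun _ i j _ _ hf hA hAeq => admOfTame_rel_avg1_pow i j hf hA hAeq

end Summit.KontsevichZagierPeriods.FurushoPentagon.SectorToKernel
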